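import Summits.Langlands.Langlands.Theorems.SoloInformedRepairD2StRing
import Mathlib.LinearAlgebra.Eigenspace.Basic
import HarnessLib
import HarnessLib.Audit.Tags

/-!
# Repair D2-st, part 2 — the semistable Weil–Deligne clause at `v ∣ ℓ` over the constructed `B_st(K_v)`

Summit `Langlands`.  Part 1 (`Theorems/SoloInformedRepairD2StRing`) constructed `B_st(F) = B_max(F)[X]` with
`φ`, `N = -d/dX`, `Γ_F` (Kummer cocycle of `p`), and `D_st(ρ_v) = (ℚ̄_p^m ⊗ B_st(F))^{Γ_F}` with `φ_D`, `N_D`,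
`N_D φ_D = p φ_D N_D`.  This file states, over those objects and with NO pinned `p`-adic Hodge datum, the
clause of Buzzard–Gee Conj. 3.2.2 that repair D2-cris could not type: at `v ∣ ℓ`, whenever `rec(π_v)` is
trivial on inertia, `ρ|Γ_{K_v}` is SEMISTABLE and the Weil–Deligne representation of `D_st(ρ|Γ_{K_v})`
has the Frobenius-semisimple type of `rec(π_v)` — Frobenius AND monodromy.

* `SemistableCompatibleAt 𝓡 ι π ρ v hv` has the shape of the Statement's `LocalGlobalCompatibleAt` at
  `v ∣ ℓ` (same `πv`, `r`, `rℂ`, `IsTransportAlong ι`, `HasFrobSemisimpleClass ((𝓡.llc v).recGL n ⟦πv⟧)`),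
  with the pinned `(𝓡.pst ℓ v hv).IsWeilDeligneOf (ρ.toLocal v) r` replaced by a comparison COMPUTED from
  `D = D_st(ρ.toLocal v)`, under the extra hypothesis `∀ w ∈ I_{K_v}, r.ρ w = 1`: (i) `Module.Finite` and
  `finrank_{ℚ̄_ℓ} D = n·f`, `f = f(v|ℓ) = v.asIdeal.inertiaDeg ℤ` (the typed proxy for "semistable":
  classically `dim_{F₀} D_st ≤ n` with equality iff semistable, and `D` is an `F₀ ⊗ ℚ̄_ℓ`-module, so its
  `ℚ̄_ℓ`-rank is `n·[F₀ : ℚ_ℓ] = n·f`); (ii) for every `w ∈ W_{K_v}` with `WeilGroup.deg w = -1` (a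
  geometric Frobenius, tree convention) and all `c, k`: `d_{(φ_D^f, N_D)}(c,k) = f · d_{(r.ρ w, r.N)}(c,k)`,
  where `d_{(Φ,N)}(c,k) = dim (ker N^k ∩ V_c(Φ))` is the JORDAN DATUM (`jordanDatum`, `V_c` = maximal
  generalised eigenspace).
* Why this is the right comparison (Fontaine's recipe, Exp. VIII §2.3.7; elementary linear algebra, not
  formalised here).  `D = ⊕_τ D_τ` over the `f` embeddings `τ : F₀ → ℚ̄_ℓ`; `Φ := φ^f` and `N` preserve each
  `D_τ`; `WD(ρ_v) := (D_τ, Frob_geom ↦ φ^f, N)`, inertia trivial, is independent of `τ` up to isomorphism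
  because `φ : D_τ ⥲ D_{τ'}` intertwines `(φ^f, N)` with `(φ^f, p⁻¹N)`; and `d` is blind to rescaling `N`,
  blind to Frobenius-semisimplification (`V_c(Φ) = V_c(Φ^{ss})`, and `(r, N)^{F-ss} = (r^{ss}, N)`), and
  DETERMINES the isomorphism class of a Frobenius-semisimple pair (`Φ` semisimple, `N` nilpotent,
  `NΦ = qΦN`, i.e. `⊕ Sp_{m_i}(c_i)`): the number of strings of length `m` with top eigenvalue `c` is
  `a(c,m) - a(qc,m+1)`, `a(c,k) := d(c,k) - d(c,k-1)`.  Hence, given (i), clause (ii) for one geometric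
  Frobenius `w` says exactly `WD(ρ_v)^{F-ss} ≅ r^{F-ss}` (`= ι⁻¹ rec(π_v)` up to F-ss), τ-free and basis-free.
* Normalisations agree.  Covariant `D`, geometric Frobenius `↦ φ^f`: the cyclotomic character has
  `D ∋ t⁻¹ ⊗ e` with `φ = p⁻¹` (tree: `D2Cris.frobBmax_tInv`), i.e. the unramified type `Frob_geom ↦ q⁻¹` of
  its `ℓ'`-adic companions.  Monodromy: the tree's `WeilDeligneRep.conj_N` reads `Φ N = q^{deg Φ} N Φ =
  q⁻¹ N Φ` for `deg Φ = -1`, and part 1's `NDst_phiDst` gives `N_D φ_D^f = ℓ^f φ_D^f N_D = q φ_D^f N_D` — the same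
  relation `N Φ = q Φ N` on both sides (`N` lowers `Φ`-eigenvalues by the factor `q`), so the data compare.
  Example (`n = 2`, `π_v` an unramified twist of Steinberg, `rec(π_v) = Sp₂(c)`): the clause demands
  `ρ|Γ_{K_v}` semistable NON-crystalline, `Φ`-eigenvalues `{c, c q⁻¹}` (`f` times each), `N_D ≠ 0` from the
  `c`-string to the `cq⁻¹`-string — the Tate-curve shape `x = t⁻¹ ⊗ e`, `y = -log[q̃] t⁻¹ ⊗ e + 1 ⊗ f`,
  `φ x = p⁻¹ x`, `φ y = y`, `N y ∈ ℚ^× · x` (Berger, Ch. II); the `GL₂` certificate of this shape over the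
  constructed ring is filed separately (`Theorems/SoloInformedRepairD2StGLTwo`).
* Scope.  `CorrespondsD2St := CorrespondsD2Cris ∧ ∀ v ∣ ℓ, SemistableCompatibleAt`; (A)/(B)/`GL_n` and
  `@[conjecture] LanglandsD2St` copy the summit's quantifier shape verbatim; ladder
  `LanglandsD2St → LanglandsD2Cris → LanglandsR3plus` (`langlandsD2Cris_of_langlandsD2St`,
  `langlandsR3plus_of_langlandsD2St`, modulo the Deligne–Serre hypothesis for the uniqueness half of (A),
  exactly as in D2-cris).  Asserted beyond D2-cris: the full WD type at `v ∣ ℓ` whenever `rec(π_v)` is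
  trivial on inertia (`π_v` Iwahori-spherical).  Still NOT typed (relative to the Statement's intended
  clause): places where `rec(π_v)` has non-trivial inertial type — there the clause is vacuous and only
  D2-cris binds (`D_pst` with its descent datum is spec items WP5-pst/WP6, not in the tree).  At `v ∣ ℓ` with
  `π_v` unramified both clauses bind: this one gives `N_D = 0` and the `Φ`-multiplicities of `r(Frob_geom)`,
  `CrystallineCompatibleAt` the characteristic polynomial of `φ^f` against the Satake parameter; that
  `recGL(π_v)` and the Satake parameter agree is the reciprocity datum's business (`llc_isCanonical`), not
  asserted here.  NOT claimed: `LanglandsD2St ↔ Langlands` in either direction (the Statement's `pst` is a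
  pinned datum; the standing PinExclusion verdict is untouched), `B_st^{Γ} = F₀`, `dim D_st ≤ n`,
  bijectivity of `φ_D`.
* Vacuity / junk values.  `WeilGroup.deg` is `0` off Frobenius powers (its facts are threaded as named
  hypotheses in the tree); should no `w` have `deg w = -1`, conjunct (ii) is vacuous at that `v` — the same
  exposure as every Frobenius statement in the tree, and (i) still binds.  `c` ranges over all of `ℚ̄_ℓ`,
  including `0` (`r.ρ w` is invertible, so (ii) at `c = 0` asserts `Φ_D` has no generalised `0`-eigenvector,
  true of the intended object); `k = 0` is trivial.  The instance facts of `K_v` (`CharZero`, `ℓ` a non-unit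
  of `𝒪_{ℂ_{K_v}}`, adic completeness) are built from `hv` as in `D2Cris.CrystallineCompatibleAt`.
A Theorems-side shadow for the operator's decision between the repairs R3⁺ / D2-cris / D2-st / D2-min; the
Statement is operator-owned and unchanged.
-/

noncomputable section

open scoped MatrixGroups Matrix Classical Polynomial NumberField TensorProduct
open NumberField IsDedekindDomain Field Polynomial Filter
open Literature.NumberTheory.Automorphic Literature.NumberTheory.GaloisRepresentations
open Literature.NumberTheory.PAdicHodge

namespace Summit.Langlands.Langlands.Theorems

namespace D2St

open D2Cris

/-! ### §4 The semistable Weil–Deligne clause at `v ∣ ℓ` and the re-scoped correspondence -/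

section Clause

variable {n : ℕ} {K : Type} [Field K] [NumberField K] {hcpt : isCompact_glFiniteIntegralLevel n K}
  {ℓ : ℕ} [Fact ℓ.Prime]

/-- **The Jordan datum of a pair `(Φ, N)`**: `d(c, k) = dim (ker N^k ∩ V_c(Φ))`, `V_c(Φ)` the maximal
generalised `c`-eigenspace.  For a Frobenius-semisimple Weil–Deligne representation trivial on inertia
(`⊕ Sp_{m_i}(λ_i)`) the function `d` determines and is determined by the isomorphism class, and it is
blind to Frobenius-semisimplification (`V_c(Φ) = V_c(Φ_ss)`) and to rescaling `N`. [cite: TateCorvallis1979, (4.1.3)–(4.1.6)]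
[cite: Rohrlich1994, §3 and §5] -/
def jordanDatum {C V : Type*} [Field C] [AddCommGroup V] [Module C V] (Φ N : Module.End C V)
    (c : C) (k : ℕ) : ℕ :=
  Module.finrank C ↥(LinearMap.ker (N ^ k) ⊓ Φ.maxGenEigenspace c)

/-- **Semistable Weil–Deligne compatibility at a place `v ∣ ℓ`** (Buzzard–Gee Conj. 3.2.2, the `p`-adic
Hodge-type clause `WD(ρ|Γ_{K_v})^{F-ss} ≅ rec(π_v)` at the places where `rec(π_v)` is trivial on inertia —
`π_v` with Iwahori-fixed vectors —, for `GL_n`): for every local component `π_v` of `π` at `v`, every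
Weil–Deligne representation `r` over `ℚ̄_ℓ` TRIVIAL ON INERTIA whose transport `rℂ = ι(r)` has
Frobenius-semisimple class `rec_v(π_v)` (the summit's own `IsTransportAlong`, `HasFrobSemisimpleClass`,
`ReciprocityData.llc`), `D = D_st(ρ|Γ_{K_v})` — over the constructed `B_st(K_v) = B_max(K_v)[X]`, for the
canonical instance facts of `K_v` — is finite over `ℚ̄_ℓ` of rank `n·f(v|ℓ)` (i.e. `ρ|Γ_{K_v}` is
SEMISTABLE, `f(v|ℓ) = v.asIdeal.inertiaDeg ℤ`) and, for every `w ∈ W_{K_v}` of degree `-1` (a geometric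
Frobenius), the Jordan data agree: `d_{(φ_D^f, N_D)}(c, k) = f · d_{(r(w), N_r)}(c, k)` for all `c, k`
(Fontaine: `WD(D_st)(Frob_geom) = φ^f`, `N ↦ N`; the `f` pieces `D_τ` are permuted by `φ`, which
intertwines `(φ^f, N)` with `(φ^f, p N)`, so they share one Jordan datum).  No pinned `p`-adic Hodge
datum occurs. [cite: BuzzardGeeLMS2014, Conj. 3.2.2] [cite: FontaineAsterisque223VIII, §2.3.7]
[cite: TateCorvallis1979, (4.1.3)–(4.2.1)] -/
def SemistableCompatibleAt (𝓡 : ReciprocityData K) (ι : PadicAlgCl ℓ ≃+* ℂ)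
    (π : AutomorphicRepData (AutomorphyDatum.gl n K hcpt)) (ρ : FramedGaloisRep K (PadicAlgCl ℓ) n)
    (v : HeightOneSpectrum (𝓞 K)) (hv : ((ℓ : ℕ) : 𝓞 K) ∈ v.asIdeal) : Prop :=
  haveI := LocalField.charZero_adicCompletion v
  haveI : Fact (¬ IsUnit ((ℓ : ℕ) : integerC (v.adicCompletion K))) :=
    ⟨not_isUnit_natCast_integerC (LocalField.valuation_adicCompletion_natCast_lt_one v ℓ hv)⟩
  haveI : IsAdicComplete (Ideal.span {((ℓ : ℕ) : integerC (v.adicCompletion K))})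
      (integerC (v.adicCompletion K)) :=
    isAdicComplete_integerC_natCast (LocalField.valuation_adicCompletion_natCast_lt_one v ℓ hv)
  ∀ (πv : SmoothIrrep (GL (Fin n) (v.adicCompletion K)))
    (r : WeilDeligneRep (v.adicCompletion K) (PadicAlgCl ℓ) (Fin n → PadicAlgCl ℓ))
    (rℂ : WeilDeligneRep (v.adicCompletion K) ℂ (Fin n → ℂ)),
    π.HasLocalComponentAt v πv.ρ → r.IsTransportAlong (ι : PadicAlgCl ℓ →+* ℂ) rℂ →
    rℂ.HasFrobSemisimpleClass ((𝓡.llc v).recGL n (IrrClass.mk πv)) →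
    (∀ w ∈ WeilGroup.inertia (v.adicCompletion K), r.ρ w = 1) →
      Module.Finite (PadicAlgCl ℓ) (Dst (p := ℓ) (ρ.toLocal v)) ∧
      Module.finrank (PadicAlgCl ℓ) (Dst (p := ℓ) (ρ.toLocal v)) = n * v.asIdeal.inertiaDeg ℤ ∧
      ∀ w : WeilGroup (v.adicCompletion K), WeilGroup.deg w = -1 → ∀ (c : PadicAlgCl ℓ) (k : ℕ),
        jordanDatum (V := Dst (p := ℓ) (ρ.toLocal v))
            (phiDst (p := ℓ) (ρ.toLocal v) ^ v.asIdeal.inertiaDeg ℤ) (NDst (p := ℓ) (ρ.toLocal v)) c k =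
          v.asIdeal.inertiaDeg ℤ * jordanDatum (r.ρ w) r.N c k

/-- **`π` and `ρ` correspond, D2-st form**: the D2-cris clauses (`D2Cris.CorrespondsD2Cris`: R3⁺ and
crystalline Frobenius–Satake compatibility at every `v ∣ ℓ`) and semistable Weil–Deligne compatibility
at every `v ∣ ℓ`. [cite: BuzzardGeeLMS2014, Conj. 3.2.1 and Conj. 3.2.2] -/
def CorrespondsD2St (𝓡 : ReciprocityData K) (ι : PadicAlgCl ℓ ≃+* ℂ)
    (π : AutomorphicRepData (AutomorphyDatum.gl n K hcpt)) (ρ : FramedGaloisRep K (PadicAlgCl ℓ) n) : Prop :=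
  CorrespondsD2Cris 𝓡 ι π ρ ∧
    ∀ (v : HeightOneSpectrum (𝓞 K)) (hv : ((ℓ : ℕ) : 𝓞 K) ∈ v.asIdeal), SemistableCompatibleAt 𝓡 ι π ρ v hv

variable (n) in
/-- **(A) Automorphic → Galois, D2-st form** — the summit's `AutomorphicToGalois` verbatim with
`Corresponds` replaced by `CorrespondsD2St`. [cite: BuzzardGeeLMS2014, Conj. 3.2.1 and Conj. 3.2.2] -/
def AutomorphicToGaloisD2St (𝓡 : ReciprocityData K) (hcpt : isCompact_glFiniteIntegralLevel n K) : Prop :=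
  ∀ π : CuspidalAutomorphicRepData n K hcpt, π.1.IsLAlgebraic →
    ∀ (ℓ : ℕ) [Fact ℓ.Prime] (ι : PadicAlgCl ℓ ≃+* ℂ),
      ∃ ρ : FramedGaloisRep K (PadicAlgCl ℓ) n,
        ρ.toGaloisRep.IsIrreducible ∧ IsGeometricFramed 𝓡 ρ ∧ CorrespondsD2St 𝓡 ι π.1 ρ ∧
          ∀ ρ' : FramedGaloisRep K (PadicAlgCl ℓ) n, CorrespondsD2St 𝓡 ι π.1 ρ' → IsConjugate ρ ρ'

variable (n) in
/-- **(B) Galois → automorphic, D2-st form** — the summit's `GaloisToAutomorphic` verbatim with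
`Corresponds` replaced by `CorrespondsD2St`. [cite: FontaineMazurGeometric1995, Conj. 1]
[cite: BuzzardGeeLMS2014, Conj. 3.2.2] -/
def GaloisToAutomorphicD2St (𝓡 : ReciprocityData K) (hcpt : isCompact_glFiniteIntegralLevel n K) : Prop :=
  ∀ (ℓ : ℕ) [Fact ℓ.Prime] (ι : PadicAlgCl ℓ ≃+* ℂ) (ρ : FramedGaloisRep K (PadicAlgCl ℓ) n),
    ρ.toGaloisRep.IsIrreducible → IsGeometricFramed 𝓡 ρ →
      ∃ π : CuspidalAutomorphicRepData n K hcpt, π.1.IsLAlgebraic ∧ CorrespondsD2St 𝓡 ι π.1 ρ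

variable (n K) in
/-- **Global Langlands reciprocity for `GL_n` over `K`, D2-st form**: (A) ∧ (B).
[cite: BuzzardGeeLMS2014, Conj. 3.2.2] [cite: FontaineMazurGeometric1995, Conj. 1] -/
def GlobalLanglandsCorrespondenceGLnD2St (𝓡 : ReciprocityData K)
    (hcpt : isCompact_glFiniteIntegralLevel n K) : Prop :=
  AutomorphicToGaloisD2St n 𝓡 hcpt ∧ GaloisToAutomorphicD2St n 𝓡 hcpt

end Clause

end D2St

/-- **`LanglandsD2St`** — the summit `Langlands` with its `v ∣ ℓ` local clause re-scoped to R3⁺ PLUS, at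
every `v ∣ ℓ`, crystalline Frobenius–Satake compatibility when `π_v` is unramified (D2-cris) and
semistability with the full Weil–Deligne type of `rec(π_v)` (Frobenius AND monodromy, through the Jordan
datum) when `rec(π_v)` is trivial on inertia, typed over the constructed `B_st(K_v) = B_max(K_v)[X]` whose
Galois structure is the tree's Kummer cocycle of `p` (no pinned datum): same outer quantifier shape as
`Langlands`.  OPEN named conjecture stated in our theories (obligation node, `@[conjecture]`; not a
Literature fact, not the operator's Statement — a Theorems-side shadow of repair option D2-st, between
D2-cris and D2-min). [cite: BuzzardGeeLMS2014, Conj. 3.2.1 and Conj. 3.2.2] [cite: FontaineMazurGeometric1995, Conj. 1] -/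
@[conjecture] def LanglandsD2St : Prop :=
  ∀ (F : Type) [Field F] [NumberField F],
    Nonempty (Summit.Langlands.ReciprocityData F) ∧
      ∀ (𝓡 : Summit.Langlands.ReciprocityData F) (n : ℕ), 0 < n →
        ∀ hcpt : isCompact_glFiniteIntegralLevel n F,
          D2St.GlobalLanglandsCorrespondenceGLnD2St n F 𝓡 hcpt

/-- **The repair ladder: `LanglandsD2St → LanglandsD2Cris`** (given Deligne–Serre uniqueness for the
uniqueness clause of (A), as for `langlandsR3plus_of_langlandsD2Cris`). [cite: DeligneSerreASENS1974, Lemme 3.2 (p. 513)] -/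
theorem langlandsD2Cris_of_langlandsD2St
    (hDS : ∀ (K : Type) [Field K] [NumberField K] (ℓ n : ℕ) [Fact ℓ.Prime],
      D2Cris.DeligneSerreUniqueness K ℓ n)
    (h : LanglandsD2St) : LanglandsD2Cris := by
  intro F _ _
  obtain ⟨hne, hall⟩ := h F
  refine ⟨hne, fun 𝓡 n hn hcpt => ?_⟩
  obtain ⟨hA, hB⟩ := hall 𝓡 n hn hcpt
  refine ⟨fun π hπ ℓ _ ι => ?_, fun ℓ _ ι ρ hirr hgeo => ?_⟩
  · obtain ⟨ρ, hirr, hgeo, hcor, _⟩ := hA π hπ ℓ ι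
    exact ⟨ρ, hirr, hgeo, hcor.1, fun ρ' h' =>
      hDS F ℓ n ρ ρ' hirr (R3plus.eventually_frobCharpoly_of_correspondsR3plus hcor.1.1 h'.1)⟩
  · obtain ⟨π, hπ, hcor⟩ := hB ℓ ι ρ hirr hgeo
    exact ⟨π, hπ, hcor.1⟩

/-- **`LanglandsD2St → LanglandsR3plus`** (composition of the two rungs). [cite: DeligneSerreASENS1974, Lemme 3.2 (p. 513)] -/
theorem langlandsR3plus_of_langlandsD2St
    (hDS : ∀ (K : Type) [Field K] [NumberField K] (ℓ n : ℕ) [Fact ℓ.Prime],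
      D2Cris.DeligneSerreUniqueness K ℓ n)
    (h : LanglandsD2St) : LanglandsR3plus :=
  langlandsR3plus_of_langlandsD2Cris hDS (langlandsD2Cris_of_langlandsD2St hDS h)

end Summit.Langlands.Langlands.Theorems

end
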